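import Summits.KontsevichZagierPeriods.KontsevichZagierPeriods.Theorems.SoloBlindZetaTwoSquare
import Summits.KontsevichZagierPeriods.KontsevichZagierPeriods.Statement
import Mathlib.RingTheory.AlgebraicIndependent.Transcendental
import HarnessLib

/-!
# Sectors of the Kontsevich–Zagier conjecture and the sector principle

Let `Q = FormalRep ⧸ relations` be the ring of formal integral representations modulo
Kontsevich–Zagier's three rules (`SoloBlindBoxRing`), a commutative `K₀ = ℚ̄ ∩ ℝ`-algebra with the
period map `evalQ : Q →ₐ[K₀] ℝ`.

**The sector principle** (`sector_kernel`, `kz_sector`, `sector_kernel_iff`). For a family of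
classes `g : ι → Q` let the *sector* `M(g) ⊆ FormalRep` consist of all formal `ℤ`-combinations of
integral representations whose class is a `K₀`-polynomial in the `g i`. If the periods
`evalQ (g i)` are algebraically independent over `K₀`, the conjecture holds on `M(g)`: two
representations in `M(g)` with the same period are equivalent under the three rules. Sharpness:
the periods are algebraically independent iff the `g i` are formally independent in `Q` AND the
conjecture holds on `M(g)` — sector by sector, the conjecture is exactly a transcendence statement.

**The global form** (`kz_of_injective_evalQ`, `injective_evalQ_iff`,
`injective_evalQ_iff_transcendental`). The summit statement `Literature.Periods.KZPeriodConjecture`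
follows from the injectivity of `evalQ` (= the conjecture for all representations with algebraic
data, in kernel form), and injectivity splits into two halves of different nature:
(D) `Q` has no zero-divisors, and (T) every formally transcendental class has a transcendental
period — equivalently (T') formally independent families have algebraically independent periods.
So a counterexample to the conjecture (algebraic data) is either a pair of zero-divisors in the
formal period ring or a formally transcendental class with an algebraic period.

Reference: M. Kontsevich, D. Zagier, *Periods* (2001), §1.2 (Conjecture 1) and §4.1/4.2 (the
conjecture as the statement that the formal period algebra maps isomorphically to periods).
-/

noncomputable section

namespace Summit.KontsevichZagierPeriods.KontsevichZagierPeriods.Theorems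

open Set
open Literature.NumberTheory.Transcendental
open Literature.NumberTheory.Transcendental.KZ

namespace SoloBlind

/-! ## Sectors and the sector principle -/

/-- **The sector of a set of classes** `S ⊆ Q`: all formal combinations of integral
representations whose class modulo the moves is a `ℚ̄`-polynomial in `S`. -/
def sector (S : Set Q) : NonUnitalSubring FormalRep where
  carrier := {z | mkQ z ∈ Algebra.adjoin K₀ S}
  zero_mem' := by
    simp only [mem_setOf_eq, map_zero]
    exact zero_mem _
  add_mem' := fun ha hb => by
    simp only [mem_setOf_eq, map_add]
    exact add_mem ha hb
  neg_mem' := fun ha => by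
    simp only [mem_setOf_eq, map_neg]
    exact neg_mem ha
  mul_mem' := fun ha hb => by
    simp only [mem_setOf_eq, mkQ_mul]
    exact mul_mem ha hb

/-- Membership in a sector, unfolded. -/
theorem mem_sector {S : Set Q} {z : FormalRep} : z ∈ sector S ↔ mkQ z ∈ Algebra.adjoin K₀ S :=
  Iff.rfl

/-- Every relation lies in every sector. -/
theorem relations_le_sector (S : Set Q) {z : FormalRep} (hz : z ∈ relations) : z ∈ sector S := by
  rw [mem_sector, mkQ_eq_zero_iff.mpr hz]
  exact zero_mem _

/-- Sectors are monotone. -/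
theorem sector_mono {S T : Set Q} (h : S ⊆ T) : sector S ≤ sector T := fun _ hz =>
  Algebra.adjoin_mono h hz

/-- The tame `π`-sector is the sector of `x_π`. -/
theorem piSector_eq_sector : piSector = sector {xPi} := rfl

/-- **The sector principle (kernel form).** If the periods of a family of classes are
algebraically independent over `ℚ̄ ∩ ℝ`, every element of its sector with period `0` is a
consequence of the three rules. -/
theorem sector_kernel {ι : Type} {g : ι → Q} (hg : AlgebraicIndependent K₀ fun i => evalQ (g i))
    {z : FormalRep} (hz : z ∈ sector (range g)) (h0 : eval z = 0) : z ∈ relations := by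
  rw [mem_sector, Algebra.adjoin_range_eq_range_aeval, AlgHom.mem_range] at hz
  obtain ⟨p, hp⟩ := hz
  have hp0 : MvPolynomial.aeval (fun i => evalQ (g i)) p = 0 := by
    have h1 := congrArg evalAlgHom hp
    rw [evalAlgHom_mkQ, h0, ← AlgHom.comp_apply, MvPolynomial.comp_aeval] at h1
    exact h1
  have hp' : p = 0 := (algebraicIndependent_iff.mp hg) p hp0
  rw [← mkQ_eq_zero_iff, ← hp, hp', map_zero]

/-- **The sector principle.** If the periods of a family of classes are algebraically independent
over `ℚ̄ ∩ ℝ`, the Kontsevich–Zagier conjecture holds on its sector. -/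
theorem kz_sector {ι : Type} {g : ι → Q} (hg : AlgebraicIndependent K₀ fun i => evalQ (g i))
    {n m : ℕ} (r : IntegralRep n) (r' : IntegralRep m) (hr : of r ∈ sector (range g))
    (hr' : of r' ∈ sector (range g)) (hv : r.value = r'.value) : Equivalent r r' :=
  sector_kernel hg (sub_mem hr hr') (by rw [map_sub, eval_of, eval_of, hv, sub_self])

/-- Independent periods come from formally independent classes. -/
theorem algebraicIndependent_of_evalQ {ι : Type} {g : ι → Q}
    (hg : AlgebraicIndependent K₀ fun i => evalQ (g i)) : AlgebraicIndependent K₀ g :=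
  AlgebraicIndependent.of_comp evalAlgHom hg

/-- **The sector principle is sharp.** For a family of classes `g`, the periods `evalQ (g i)` are
algebraically independent over `ℚ̄ ∩ ℝ` if and only if the `g i` are formally independent in `Q`
AND the conjecture holds on the sector of `g` (every element of period `0` is a relation). -/
theorem sector_kernel_iff {ι : Type} (g : ι → Q) :
    (AlgebraicIndependent K₀ fun i => evalQ (g i)) ↔ AlgebraicIndependent K₀ g ∧
      ∀ z ∈ sector (range g), eval z = 0 → z ∈ relations := by
  refine ⟨fun hg => ⟨algebraicIndependent_of_evalQ hg, fun z hz h0 => sector_kernel hg hz h0⟩,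
    fun ⟨hg, hk⟩ => ?_⟩
  rw [algebraicIndependent_iff]
  intro p hp
  obtain ⟨w, hw⟩ := mkQ_surjective (MvPolynomial.aeval g p)
  have hmem : w ∈ sector (range g) := by
    rw [mem_sector, hw, Algebra.adjoin_range_eq_range_aeval]
    exact ⟨p, rfl⟩
  have h0 : eval w = 0 := by
    rw [← evalAlgHom_mkQ, hw, ← AlgHom.comp_apply, MvPolynomial.comp_aeval]
    exact hp
  have hw0 : MvPolynomial.aeval g p = 0 := by rw [← hw, mkQ_eq_zero_iff.mpr (hk w hmem h0)]
  exact (algebraicIndependent_iff.mp hg) p hw0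

/-! ## The global form: injectivity of the period map -/

/-- `Q` is nontrivial: the point cell has period `1 ≠ 0`. -/
instance nontrivial_Q : Nontrivial Q :=
  ⟨⟨0, 1, fun h => by simpa using congrArg evalQ h⟩⟩

/-- **The summit statement follows from the injectivity of the period map** `evalQ`. -/
theorem kz_of_injective_evalQ (h : Function.Injective evalQ) :
    Literature.Periods.KZPeriodConjecture := by
  intro n m r r' _ _ hv
  rw [Equivalent, ← mkQ_eq_mkQ_iff]
  apply h
  rw [evalQ_mkQ, evalQ_mkQ, eval_of, eval_of, hv]

/-- Injectivity of `evalQ` in kernel form: every formal combination of representations (with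
algebraic data) of period `0` is a consequence of the three rules. -/
theorem injective_evalQ_iff_kernel :
    Function.Injective evalQ ↔ ∀ z : FormalRep, eval z = 0 → z ∈ relations := by
  rw [injective_iff_map_eq_zero]
  refine ⟨fun h z hz => mkQ_eq_zero_iff.mp (h _ (by rw [evalQ_mkQ, hz])), fun h x hx => ?_⟩
  obtain ⟨z, rfl⟩ := mkQ_surjective x
  exact mkQ_eq_zero_iff.mpr (h z (by rwa [evalQ_mkQ] at hx))

/-- (D) from injectivity: the formal period ring has no zero-divisors. -/
theorem noZeroDivisors_of_injective_evalQ (h : Function.Injective evalQ) : NoZeroDivisors Q :=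
  h.noZeroDivisors evalQ (map_zero _) (map_mul _)

/-- (T') from injectivity: formally independent classes have algebraically independent periods. -/
theorem transfer_of_injective_evalQ (h : Function.Injective evalQ) {ι : Type} {g : ι → Q}
    (hg : AlgebraicIndependent K₀ g) : AlgebraicIndependent K₀ fun i => evalQ (g i) :=
  hg.map' (f := evalAlgHom) h

/-- In a formal period ring without zero-divisors, a class which is algebraic over `K₀` and has
period `0` vanishes (its minimal polynomial is irreducible with constant term `0`, hence `X`). -/
theorem eq_zero_of_isAlgebraic_of_evalQ [NoZeroDivisors Q] {x : Q} (hx : IsAlgebraic K₀ x)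
    (h0 : evalQ x = 0) : x = 0 := by
  haveI : IsDomain Q := NoZeroDivisors.to_isDomain Q
  have hint : IsIntegral K₀ x := hx.isIntegral
  have hirr : Irreducible (minpoly K₀ x) := minpoly.irreducible hint
  have hc : (minpoly K₀ x).coeff 0 = 0 := by
    have h1 : Polynomial.aeval (evalQ x) (minpoly K₀ x) = 0 := by
      rw [← evalAlgHom_apply, Polynomial.aeval_algHom_apply, minpoly.aeval, map_zero]
    rw [h0, ← Polynomial.coeff_zero_eq_aeval_zero'] at h1
    exact (map_eq_zero_iff _ (algebraMap K₀ ℝ).injective).mp h1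
  obtain ⟨u, hu⟩ :=
    Polynomial.irreducible_X.associated_of_dvd hirr (Polynomial.X_dvd_iff.mpr hc)
  have h2 : x * Polynomial.aeval x (↑u : Polynomial K₀) = 0 := by
    have h3 := minpoly.aeval K₀ x
    rwa [← hu, map_mul, Polynomial.aeval_X] at h3
  exact (IsUnit.mul_left_eq_zero ((Units.isUnit u).map (Polynomial.aeval x))).mp h2

/-- **Injectivity ⟺ (D) no zero-divisors ∧ (T) formally transcendental classes have
transcendental periods.** -/
theorem injective_evalQ_iff_transcendental :
    Function.Injective evalQ ↔ NoZeroDivisors Q ∧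
      ∀ x : Q, Transcendental K₀ x → Transcendental K₀ (evalQ x) := by
  refine ⟨fun h => ⟨noZeroDivisors_of_injective_evalQ h, fun x hx => ?_⟩, fun ⟨hD, hT⟩ => ?_⟩
  · have h1 := transfer_of_injective_evalQ h (algebraicIndependent_iff_transcendental.mpr hx)
    simpa using h1.transcendental 0
  · rw [injective_iff_map_eq_zero]
    intro x hx
    by_contra hne
    have halg : IsAlgebraic K₀ x := by
      by_contra htr
      exact hT x htr (hx ▸ isAlgebraic_zero)
    exact hne (eq_zero_of_isAlgebraic_of_evalQ halg hx)

/-- **Injectivity ⟺ (D) ∧ (T')**: no zero-divisors, and formally independent families have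
algebraically independent periods. -/
theorem injective_evalQ_iff :
    Function.Injective evalQ ↔ NoZeroDivisors Q ∧
      ∀ (ι : Type) (g : ι → Q), AlgebraicIndependent K₀ g →
        AlgebraicIndependent K₀ fun i => evalQ (g i) := by
  refine ⟨fun h => ⟨noZeroDivisors_of_injective_evalQ h, fun ι g hg =>
    transfer_of_injective_evalQ h hg⟩, fun ⟨hD, hT⟩ => ?_⟩
  refine injective_evalQ_iff_transcendental.mpr ⟨hD, fun x hx => ?_⟩
  have h1 := hT _ _ (algebraicIndependent_iff_transcendental.mpr hx)
  simpa using h1.transcendental 0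

/-- **The summit statement from (D) and (T).** -/
theorem kz_of_noZeroDivisors_of_transcendental (hD : NoZeroDivisors Q)
    (hT : ∀ x : Q, Transcendental K₀ x → Transcendental K₀ (evalQ x)) :
    Literature.Periods.KZPeriodConjecture :=
  kz_of_injective_evalQ (injective_evalQ_iff_transcendental.mpr ⟨hD, hT⟩)

end SoloBlind

end Summit.KontsevichZagierPeriods.KontsevichZagierPeriods.Theorems
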